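import Mathlib

/-!
# Oriented SDPP gadgets: the `D`-free core (solo-blind seat, s62)

For an *oriented SDPP gadget* `(P s, Q s)_{s : ι}` with difference set `D` in an abelian group
`G` (own differences `Q s - P s ⊆ D`; for `s < s'` the upper cross differences `Q s - P s'`
avoid `D`; see `SoloBlindSdppGadget.lean` for the setting and the reference
Cohn–Kleinberg–Szegedy–Umans, FOCS 2005, Def. 20 / Thm. 23 / Prop. 24), the set `D` can be
eliminated from the two conditions that CHAIN different pairs.  Writing `A s := -P s`,
`B s := Q s`, the chaining conditions read, for `s < s'`,

* `(A s' - A s) ∩ (B s - B s) = ∅`, i.e. `(P s - P s') ∩ (Q s - Q s) = ∅`;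
* `(B s - B s') ∩ (A s' - A s') = ∅`, i.e. `(Q s - Q s') ∩ (P s' - P s') = ∅`.

Both are two-line consequences of "own differences in `D`, upper cross differences outside
`D`", and they no longer mention `D`.  They are the conditions that kill translation families
and box/Behrend families of pairs in the seat's analysis of the square regime of the
two-families line (CKSU 2005, Conj. 26); this file kernel-checks exactly these two statements,
elementwise and as disjointness of pointwise difference sets.  No statement about `ω` is made.
-/

namespace Summit.MatrixMultiplication.MatrixMultiplication.Theorems

open Finset
open scoped Pointwise

variable {G : Type*} [AddCommGroup G] {ι : Type*} [Preorder ι]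

/-- First chaining condition, elementwise: for `s < s'`, no difference `p - p'` with
`p ∈ P s`, `p' ∈ P s'` equals a difference `q₁ - q₂` of two elements of `Q s`. -/
theorem soloSdpp_core_PP_QQ (P Q : ι → Finset G) (D : Finset G)
    (hown : ∀ s, ∀ p ∈ P s, ∀ q ∈ Q s, q - p ∈ D)
    (hcross : ∀ s s', s < s' → ∀ p ∈ P s', ∀ q ∈ Q s, q - p ∉ D)
    {s s' : ι} (h : s < s') {p p' q₁ q₂ : G}
    (hp : p ∈ P s) (hp' : p' ∈ P s') (hq₁ : q₁ ∈ Q s) (hq₂ : q₂ ∈ Q s) :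
    p - p' ≠ q₁ - q₂ := by
  intro heq
  have h1 : q₁ - p ∈ D := hown s p hp q₁ hq₁
  have h2 : q₂ - p' ∉ D := hcross s s' h p' hp' q₂ hq₂
  have : q₂ - p' = q₁ - p := by
    have := sub_eq_sub_iff_add_eq_add.mp heq
    -- p + q₂ = q₁ + p'  ⇒  q₂ - p' = q₁ - p
    rw [sub_eq_sub_iff_add_eq_add, add_comm q₂ p]
    exact this
  rw [this] at h2
  exact h2 h1

/-- Second chaining condition, elementwise: for `s < s'`, no difference `q - q'` with
`q ∈ Q s`, `q' ∈ Q s'` equals a difference `p₁ - p₂` of two elements of `P s'`. -/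
theorem soloSdpp_core_QQ_PP (P Q : ι → Finset G) (D : Finset G)
    (hown : ∀ s, ∀ p ∈ P s, ∀ q ∈ Q s, q - p ∈ D)
    (hcross : ∀ s s', s < s' → ∀ p ∈ P s', ∀ q ∈ Q s, q - p ∉ D)
    {s s' : ι} (h : s < s') {q q' p₁ p₂ : G}
    (hq : q ∈ Q s) (hq' : q' ∈ Q s') (hp₁ : p₁ ∈ P s') (hp₂ : p₂ ∈ P s') :
    q - q' ≠ p₁ - p₂ := by
  intro heq
  have h1 : q' - p₂ ∈ D := hown s' p₂ hp₂ q' hq'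
  have h2 : q - p₁ ∉ D := hcross s s' h p₁ hp₁ q hq
  have : q - p₁ = q' - p₂ := by
    have := sub_eq_sub_iff_add_eq_add.mp heq
    -- q + p₂ = p₁ + q'  ⇒  q - p₁ = q' - p₂
    rw [sub_eq_sub_iff_add_eq_add, add_comm q' p₁]
    exact this
  rw [this] at h2
  exact h2 h1

/-- First chaining condition as disjointness of pointwise difference sets:
for `s < s'`, `(P s - P s') ∩ (Q s - Q s) = ∅`. -/
theorem soloSdpp_core_disjoint_PP_QQ [DecidableEq G] (P Q : ι → Finset G) (D : Finset G)
    (hown : ∀ s, ∀ p ∈ P s, ∀ q ∈ Q s, q - p ∈ D)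
    (hcross : ∀ s s', s < s' → ∀ p ∈ P s', ∀ q ∈ Q s, q - p ∉ D)
    {s s' : ι} (h : s < s') :
    Disjoint (P s - P s') (Q s - Q s) := by
  rw [Finset.disjoint_left]
  intro x hx hx'
  obtain ⟨p, hp, p', hp', rfl⟩ := Finset.mem_sub.mp hx
  obtain ⟨q₁, hq₁, q₂, hq₂, hq⟩ := Finset.mem_sub.mp hx'
  exact soloSdpp_core_PP_QQ P Q D hown hcross h hp hp' hq₁ hq₂ hq.symm

/-- Second chaining condition as disjointness of pointwise difference sets:
for `s < s'`, `(Q s - Q s') ∩ (P s' - P s') = ∅`. -/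
theorem soloSdpp_core_disjoint_QQ_PP [DecidableEq G] (P Q : ι → Finset G) (D : Finset G)
    (hown : ∀ s, ∀ p ∈ P s, ∀ q ∈ Q s, q - p ∈ D)
    (hcross : ∀ s s', s < s' → ∀ p ∈ P s', ∀ q ∈ Q s, q - p ∉ D)
    {s s' : ι} (h : s < s') :
    Disjoint (Q s - Q s') (P s' - P s') := by
  rw [Finset.disjoint_left]
  intro x hx hx'
  obtain ⟨q, hq, q', hq', rfl⟩ := Finset.mem_sub.mp hx
  obtain ⟨p₁, hp₁, p₂, hp₂, hp⟩ := Finset.mem_sub.mp hx'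
  exact soloSdpp_core_QQ_PP P Q D hown hcross h hq hq' hp₁ hp₂ hp.symm

/-- The own condition with the double product property, restated without `D` as well:
`(P s - P s) ∩ (Q s - Q s) = {0}` is equivalent to injectivity of `(p, q) ↦ q - p`; here the
useful direction — a common nonzero difference contradicts injectivity — in elementwise form. -/
theorem soloSdpp_core_dpp (P Q : Finset G)
    (hdpp : ∀ p₁ ∈ P, ∀ q₁ ∈ Q, ∀ p₂ ∈ P, ∀ q₂ ∈ Q, q₁ - p₁ = q₂ - p₂ → p₁ = p₂ ∧ q₁ = q₂)
    {p₁ p₂ q₁ q₂ : G} (hp₁ : p₁ ∈ P) (hp₂ : p₂ ∈ P) (hq₁ : q₁ ∈ Q) (hq₂ : q₂ ∈ Q)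
    (heq : p₁ - p₂ = q₁ - q₂) : p₁ = p₂ := by
  have : q₂ - p₂ = q₁ - p₁ := by
    rw [sub_eq_sub_iff_add_eq_add] at heq ⊢
    -- heq : p₁ + q₂ = q₁ + p₂ ; goal : q₂ + p₁ = q₁ + p₂
    rw [add_comm q₂ p₁]
    exact heq
  exact ((hdpp p₂ hp₂ q₂ hq₂ p₁ hp₁ q₁ hq₁ this).1).symm

end Summit.MatrixMultiplication.MatrixMultiplication.Theorems
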